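import Summits.BirchSwinnertonDyer.BirchSwinnertonDyer.Theorems.ClassRecordThreeCornerAtThreeMilneTamagawaModel
import Literature.NumberTheory.EllipticCurves.UnramifiedClassTamagawaTorsion
import HarnessLib

/-!
# Milne *ADT* I Prop. 3.8 in the kernel, part 6: THE DISCHARGE — `Milne2006_localTamagawaNumber_smul_unramifiedClass_eq_zero` HOLDS
# (cell `bsd-stepL`, seat `bsd-stepL-corner3-p2` g10 = WIDTH-LEVER lane B; `ledger fact claim` of the cite-only Literature fact typed by
# tam3-p1 g15 (p614601, `Literature/NumberTheory/EllipticCurves/UnramifiedClassTamagawaTorsion.lean`); `--supports stmt-BirchSwinnertonDyer-21420 --as helper`)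

`Milne2006_localTamagawaNumber_smul_unramifiedClass_eq_zero_holds : Milne2006_localTamagawaNumber_smul_unramifiedClass_eq_zero.{u}` — for
EVERY elliptic curve `E` over a number field `K`, EVERY finite place `v` and every continuous crossed homomorphism `f : Γ_{K_v} → E(K̄_v)`
vanishing on the inertia group `I_𝔐`: `c_v • [f] = 0` in `H¹(K_v, E)`, `c_v = [E(K_v) : E₀(K_v)]` the local Tamagawa number of the tree.
Proof by reduction type: good — the tree's PROVED `Milne2006_unramifiedClass_eq_zero_holds` (tam3-p1's
`localTamagawaNumber_smul_unramifiedClass_eq_zero_of_hasGoodReductionAt`); multiplicative ∕ additive — transport `f` along the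
equivariant isomorphism `Φ : E(K̄_v) ≃ V(K̄_v)` onto the minimal model (as in `Milne2006_unramifiedClass_eq_zero_holds` and x11b3-p8's
curve forms) and apply part 5b `exists_localTamagawaNumber_nsmul_eq_map_sub_of_bad` (Kodaira–Néron over `K_v^{nr}` + Lang–Néron
surjectivity + Herbrand count + the located `E₀`-lift machinery of parts 1–4), then `oneCocycleClass_eq_zero_iff`.
CONSEQUENCE: the (B6)-precision route of the carrier-inert Shimura road (tam3-p1 g15 F0–F6; cruxes 19109 ∕ 21420 ∕ 19065) no longer rests
on a cite-only input — its `hM38`-type hypotheses are discharged by this theorem; the tree's good-reduction Milne I.3.8 is the case `c_v = 1`.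
HONEST FRAMING: two theorems (the bad-reduction case and the discharge); no definition, no named fact of its own, no `sorry`; nothing about
BSD, no stub closes, no item is credited (T7). Credit: x11b3-p8 (`UnramifiedClass*`), n1011 (`BDPRouteLocalNonsingularBridge`,
T-URTAM), p4 (`GoodReductionSubgroup*`), the tree (`PeriodIndexSupportProofs`, `KodairaNeronUnramifiedProofs`,
`LocalFrobeniusGenerationProofs`), tam3-p1 g15 (the statement). References: [cite: MilneADT2006, Ch. I Prop. 3.8]
[cite: GreenbergLNM1716, §3 Lemma 3.3 and the remark after its proof] [cite: CoatesLNM1716, §3, proof of Lemma 3.8]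
[cite: SilvermanAEC2009, VII §2 Prop. 2.1, Thm. VII.6.1, Cor. VII.6.2, §VII.6 Ex. 7.6] [cite: SilvermanATAEC1994, IV Cor. 9.2].
-/

set_option linter.dupNamespace false
set_option autoImplicit false

noncomputable section

open scoped Classical NNReal
open NumberField IsDedekindDomain Field

universe u

namespace Summit.BirchSwinnertonDyer.BirchSwinnertonDyer.Theorems.MilneTamagawa

open WeierstrassCurve Literature.NumberTheory.EllipticCurves Literature.NumberTheory.GaloisRepresentations
  IsDedekindDomain.HeightOneSpectrum

variable {K : Type u} [Field K] [NumberField K]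

set_option maxHeartbeats 1600000 in
/-- **Milne *ADT* I Prop. 3.8 at a place of MULTIPLICATIVE or ADDITIVE reduction**: for a continuous crossed homomorphism
`f : Γ_{K_v} → E(K̄_v)` vanishing on the inertia group `I_𝔐`, `c_v • [f] = 0` in `H¹(K_v, E)`. Transport to the minimal model
`V = M ⊗ K̄_v` along the tree's equivariant `Φ` (the witnesses `w`, `ι`, `C` chosen from `exists_spectralValuation`,
`exists_ringHom_adicCompletionIntegers_integer`, `exists_variableChange_eq_localMinimalIntegralModel`) and part 5b.
[cite: MilneADT2006, Ch. I Prop. 3.8] [cite: SilvermanATAEC1994, IV Cor. 9.2] -/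
theorem localTamagawaNumber_smul_oneCocycleClass_eq_zero_of_bad (W : WeierstrassCurve K) [W.IsElliptic]
    (v : HeightOneSpectrum (𝓞 K)) (hbad : W.HasMultiplicativeReductionAt v ∨ W.HasAdditiveReductionAt v)
    {𝔐 : Ideal (v.localAbsIntegers)} (h𝔐 : 𝔐 ∈ v.localPrimesAbove)
    (f : contOneCocycles (discreteTopRep (absoluteGaloisGroup (v.adicCompletion K))
        (localPoints W (v.adicCompletion K))))
    (hfI : ∀ σ ∈ 𝔐.inertia (absoluteGaloisGroup (v.adicCompletion K)), f.1 σ = 0) :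
    ((W.baseChange (v.adicCompletion K)).localTamagawaNumber (v.adicCompletionIntegers K) : ℤ) •
      oneCocycleClass (discreteTopRep (absoluteGaloisGroup (v.adicCompletion K))
        (localPoints W (v.adicCompletion K))) f = 0 := by
  obtain ⟨w, hw⟩ := v.exists_spectralValuation
  obtain ⟨ι, hι⟩ := exists_ringHom_adicCompletionIntegers_integer hw
  obtain ⟨C, hC⟩ := W.exists_variableChange_eq_localMinimalIntegralModel v
  haveI := WeierstrassCurve.isIntegral_spectralValuation_baseChange hw (W.localMinimalIntegralModel v)
  have hC' := congrArg (fun X : WeierstrassCurve (v.adicCompletion K) ↦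
    X.baseChange (AlgebraicClosure (v.adicCompletion K))) hC
  -- the equivariant transport `E(K̄_v) ≃ V(K̄_v)` (as in `Milne2006_unramifiedClass_eq_zero_holds`)
  let Φ : localPoints W (v.adicCompletion K) ≃+
      (((W.localMinimalIntegralModel v).map (algebraMap (v.adicCompletionIntegers K)
        (v.adicCompletion K))).baseChange (AlgebraicClosure (v.adicCompletion K))).toAffine.Point :=
    ((WeierstrassCurve.Affine.Point.congrEquiv (WeierstrassCurve.baseChange_baseChange_adicCompletion W v).symm).trans
      (WeierstrassCurve.VariableChange.pointEquivBaseChange (W.baseChange (v.adicCompletion K)) C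
        (AlgebraicClosure (v.adicCompletion K)))).trans
      (WeierstrassCurve.Affine.Point.congrEquiv hC')
  have hΦ : ∀ (σ : absoluteGaloisGroup (v.adicCompletion K)) (Q : localPoints W (v.adicCompletion K)),
      Φ (σ • Q) = WeierstrassCurve.Affine.Point.map ((absoluteGaloisGroup.toAlgEquiv (v.adicCompletion K) σ :
          AlgebraicClosure (v.adicCompletion K) ≃ₐ[v.adicCompletion K] AlgebraicClosure (v.adicCompletion K)) :
          AlgebraicClosure (v.adicCompletion K) →ₐ[v.adicCompletion K] AlgebraicClosure (v.adicCompletion K))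
        (Φ Q) := by
    intro σ Q
    change WeierstrassCurve.Affine.Point.congrEquiv hC' (WeierstrassCurve.VariableChange.pointEquivBaseChange (W.baseChange (v.adicCompletion K)) C
        (AlgebraicClosure (v.adicCompletion K))
        (WeierstrassCurve.Affine.Point.congrEquiv (WeierstrassCurve.baseChange_baseChange_adicCompletion W v).symm (σ • Q))) =
      WeierstrassCurve.Affine.Point.map _ (WeierstrassCurve.Affine.Point.congrEquiv hC'
        (WeierstrassCurve.VariableChange.pointEquivBaseChange (W.baseChange (v.adicCompletion K)) C
          (AlgebraicClosure (v.adicCompletion K))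
          (WeierstrassCurve.Affine.Point.congrEquiv (WeierstrassCurve.baseChange_baseChange_adicCompletion W v).symm Q)))
    rw [WeierstrassCurve.congrEquiv_smul, WeierstrassCurve.VariableChange.pointEquivBaseChange_map_algEquiv]
    exact WeierstrassCurve.Affine.Point.congrEquiv_baseChange_map hC _ _
  -- the transported crossed homomorphism
  set g : absoluteGaloisGroup (v.adicCompletion K) → _ := fun σ ↦ Φ (f.1 σ) with hgdef
  have hg : ∀ σ τ, g (σ * τ) = g σ + WeierstrassCurve.Affine.Point.map ((absoluteGaloisGroup.toAlgEquiv (v.adicCompletion K) σ :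
      AlgebraicClosure (v.adicCompletion K) ≃ₐ[v.adicCompletion K] AlgebraicClosure (v.adicCompletion K)) :
      AlgebraicClosure (v.adicCompletion K) →ₐ[v.adicCompletion K] AlgebraicClosure (v.adicCompletion K)) (g τ) := by
    intro σ τ
    simp only [hgdef]
    rw [f.2 σ τ, map_add, discreteTopRep_ρ_apply, hΦ]
  have hopen : IsOpen {σ | g σ = 0} := by
    have e : {σ | g σ = 0} = f.1 ⁻¹' {0} := by
      ext σ
      simp only [hgdef, Set.mem_setOf_eq, Set.mem_preimage, Set.mem_singleton_iff]
      exact Φ.map_eq_zero_iff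
    rw [e]
    exact (isOpen_discrete _).preimage f.1.continuous
  have hI : ∀ τ ∈ 𝔐.inertia (absoluteGaloisGroup (v.adicCompletion K)), g τ = 0 := fun τ hτ ↦ by
    simp only [hgdef, hfI τ hτ, map_zero]
  obtain ⟨P, hP⟩ := exists_localTamagawaNumber_nsmul_eq_map_sub_of_bad W hw hι hbad h𝔐 g hg hopen hI
  -- `c • [f] = [c • f]` and `c • f = ∂(Φ⁻¹ P)`
  rw [← oneCocycleClassₗ_apply, ← map_zsmul, oneCocycleClassₗ_apply, oneCocycleClass_eq_zero_iff]
  refine ⟨Φ.symm P, fun σ ↦ Φ.injective ?_⟩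
  rw [discreteTopRep_ρ_apply, map_sub, hΦ, AddEquiv.apply_symm_apply, ← hP σ]
  change Φ (((((W.baseChange (v.adicCompletion K)).localTamagawaNumber (v.adicCompletionIntegers K) : ℕ) : ℤ) • f.1) σ) =
    ((W.baseChange (v.adicCompletion K)).localTamagawaNumber (v.adicCompletionIntegers K)) • Φ (f.1 σ)
  rw [ContinuousMap.smul_apply, map_zsmul, natCast_zsmul]

/-- **DISCHARGE of `Milne2006_localTamagawaNumber_smul_unramifiedClass_eq_zero`** (Milne *ADT* I Prop. 3.8 in Tamagawa form, every
reduction type): good reduction by the tree's `Milne2006_unramifiedClass_eq_zero_holds` (tam3-p1's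
`localTamagawaNumber_smul_unramifiedClass_eq_zero_of_hasGoodReductionAt`), multiplicative ∕ additive by
`localTamagawaNumber_smul_oneCocycleClass_eq_zero_of_bad`. [cite: MilneADT2006, Ch. I Prop. 3.8]
[cite: GreenbergLNM1716, §3 Lemma 3.3 and the remark after its proof] [cite: SilvermanAEC2009, Thm. VII.6.1, Cor. VII.6.2, §VII.6 Ex. 7.6] -/
theorem Milne2006_localTamagawaNumber_smul_unramifiedClass_eq_zero_holds :
    Milne2006_localTamagawaNumber_smul_unramifiedClass_eq_zero.{u} := by
  intro K _ _ W _ v 𝔐 h𝔐 f hf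
  rcases W.hasGoodReductionAt_or_hasMultiplicativeReductionAt_or_hasAdditiveReductionAt v with hg | hm | ha
  · exact localTamagawaNumber_smul_unramifiedClass_eq_zero_of_hasGoodReductionAt W v hg h𝔐 f hf
  · exact localTamagawaNumber_smul_oneCocycleClass_eq_zero_of_bad W v (Or.inl hm) h𝔐 f hf
  · exact localTamagawaNumber_smul_oneCocycleClass_eq_zero_of_bad W v (Or.inr ha) h𝔐 f hf

end Summit.BirchSwinnertonDyer.BirchSwinnertonDyer.Theorems.MilneTamagawa

end
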